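import Summits.QuantumFields.YangMills.Theorems.LangevinControlUVOSLegsFromFemtoAndGapStubAssemblyUniformBoundMain
import HarnessLib

/-!
# Soft OS-assembly toolkit X-a: per-point bounds for ABSTRACT weights at SHIFTED evaluation points

Helper file for stub `stub_assembly6` of crux `OSLegsFromFemtoAndGap` (stmt-QuantumFields-9367, line
`dlr-collar-transfer`, reshape r2).  Toolkit VI-b/VI-c bound `Σₓ W(x) F(a x)` for the centred moments `W` of the
action density.  The reflection-positivity blocks need the same bound (i) for the centred mixed moments of plane
STRINGS (any weight `W` with a sup bound `Mⁿ` and the collar bound `(C/R⁴)ⁿ` at torus-separated sites), and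
(ii) with the test function evaluated at SHIFTED points `y(x)`, `‖y(x)_l − a x_l‖ ≤ s a` (lattice reflections act on
plaquette strings only up to per-argument one-step shifts).  This file proves the per-point
half (`weight_bound_wrap'/near'/far'`, `pointwise_bound'`); the summed bound `norm_sum_weight_mul_le` — for `F ∈ ⁰𝒮ₙ` (`n ≥ 2`), `0 < a ≤ 1`, `s a ≤ 1/4`, `0 ≤ s ≤ 6`, `a ≤ ℓ₄`, `L ≥ 14`,
`L ≥ a⁻²`:  `‖Σ_{x ∈ (box L)ⁿ} W(x) F(y(x))‖ ≤ Kⁿ (S₀,₄ₙ + S₆ₙ,₄ₙ + S₀,₀ + S₆ₙ,₀ + S₁₀ₙ,₀)(F)` with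
`K = (M 4⁴5⁶ + M 2⁶(10+2s)⁴ + 16C 2⁶(2/ℓ₄+48)⁴) · 2⁶ · 81 Σ (m+1)⁻²`.
-/

noncomputable section

open scoped SchwartzMap BigOperators
open MeasureTheory Filter Topology
open Literature.MathematicalPhysics.QuantumFieldTheory Literature.MathematicalPhysics.QuantumLattice
open Literature.MathematicalPhysics.AQFT
open Literature.Probability.LatticeModels (box Site)

namespace Summit.QuantumFields.YangMills.Theorems.OSLegsFromFemtoAndGap

local notation "E4" => EuclideanSpace ℝ (Fin 4)

variable {n : ℕ}

/-! ### Shifted evaluation points -/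

/-- Pair separations of shifted points: `‖yᵢ − yⱼ‖ ≤ 2a‖xᵢ − xⱼ‖ + 2sa`. -/
theorem norm_sub_le_of_shift {a s : ℝ} (ha : 0 ≤ a) {x : Fin n → Site 4} {y : Fin n → E4}
    (hyx : ∀ l, ‖y l - a • siteToE (x l)‖ ≤ s * a) (i j : Fin n) :
    ‖y i - y j‖ ≤ 2 * a * ‖x i - x j‖ + 2 * (s * a) := by
  have h1 := norm_smul_siteToE_sub_le ha (x i) (x j)
  have h2 : ‖y i - y j‖ ≤ ‖y i - a • siteToE (x i)‖ + ‖a • siteToE (x i) - a • siteToE (x j)‖ +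
      ‖a • siteToE (x j) - y j‖ := by
    calc ‖y i - y j‖ = ‖(y i - a • siteToE (x i)) + (a • siteToE (x i) - a • siteToE (x j)) +
          (a • siteToE (x j) - y j)‖ := by congr 1; abel
      _ ≤ _ := norm_add₃_le
  have h3 : ‖a • siteToE (x j) - y j‖ ≤ s * a := by rw [norm_sub_rev]; exact hyx j
  linarith [hyx i]

/-- Norms of shifted points: `a‖xᵢ‖ − sa ≤ ‖yᵢ‖`. -/
theorem norm_ge_of_shift {a s : ℝ} (ha : 0 ≤ a) {x : Fin n → Site 4} {y : Fin n → E4}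
    (hyx : ∀ l, ‖y l - a • siteToE (x l)‖ ≤ s * a) (i : Fin n) : a * ‖x i‖ - s * a ≤ ‖y i‖ := by
  have h1 := mul_norm_le_norm_smul_siteToE ha (x i)
  have h2 : ‖a • siteToE (x i)‖ ≤ ‖y i‖ + ‖y i - a • siteToE (x i)‖ := by
    calc ‖a • siteToE (x i)‖ = ‖y i - (y i - a • siteToE (x i))‖ := by congr 1; abel
      _ ≤ ‖y i‖ + ‖y i - a • siteToE (x i)‖ := norm_sub_le _ _
  linarith [hyx i]

/-! ### The three regimes at shifted points -/

/-- **Wrap zone, shifted.** -/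
theorem weight_bound_wrap' (F : 𝓢((Fin n → E4), ℂ)) {a s : ℝ} (ha : 0 < a) (ha1 : a ≤ 1)
    (hsa : s * a ≤ 1 / 4) {L : ℕ} (hL : a⁻¹ * a⁻¹ ≤ L) (x : Fin n → Site 4) {i : Fin n}
    (hi : (L : ℝ) < 2 * ‖x i‖) (y : Fin n → E4) (hyx : ∀ l, ‖y l - a • siteToE (x l)‖ ≤ s * a)
    {W M : ℝ} (hM : 0 ≤ M) (hW : |W| ≤ M ^ n) :
    |W| * ‖F y‖ * (1 + ‖y‖) ^ (6 * n) ≤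
      M ^ n * 4 ^ (4 * n) * 5 ^ (6 * n) * a ^ (4 * n) * SchwartzMap.seminorm ℂ (10 * n) 0 F := by
  set t := ‖y‖ with ht
  -- `t ≥ 1/(4a) ≥ 1/4`
  have hyi : a * ‖x i‖ - s * a ≤ ‖y i‖ := norm_ge_of_shift ha.le hyx i
  have hainv : (1 : ℝ) ≤ a⁻¹ := one_le_inv_iff₀.2 ⟨ha, ha1⟩
  have ht1 : a⁻¹ / 4 ≤ t := by
    have h1 : (L : ℝ) * a < 2 * (‖y i‖ + s * a) := by nlinarith
    have h2 : a⁻¹ ≤ (L : ℝ) * a := by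
      have := mul_le_mul_of_nonneg_right hL ha.le
      rwa [mul_assoc, inv_mul_cancel₀ ha.ne', mul_one] at this
    have h3 : ‖y i‖ ≤ t := norm_le_pi_norm y i
    have h4 : s * a ≤ a⁻¹ / 4 := hsa.trans (by linarith)
    linarith
  have ht2 : (1 : ℝ) / 4 ≤ t := by linarith
  have htpos : 0 < t := by linarith
  set S := SchwartzMap.seminorm ℂ (10 * n) 0 F with hS
  have hdecay : t ^ (10 * n) * ‖F y‖ ≤ S := pow_mul_norm_le_seminorm F (10 * n) y
  have h1t : (1 + t) ^ (6 * n) ≤ (5 : ℝ) ^ (6 * n) * t ^ (6 * n) := by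
    rw [← mul_pow]; exact pow_le_pow_left₀ (by positivity) (by linarith) _
  have h2t : (1 : ℝ) ≤ (4 * a) ^ (4 * n) * t ^ (4 * n) := by
    rw [← mul_pow]
    refine one_le_pow₀ ?_
    have : a⁻¹ * a = 1 := inv_mul_cancel₀ ha.ne'
    nlinarith
  have hWn : 0 ≤ |W| := abs_nonneg _
  calc |W| * ‖F y‖ * (1 + t) ^ (6 * n)
      ≤ M ^ n * ‖F y‖ * ((5 : ℝ) ^ (6 * n) * t ^ (6 * n)) := by gcongr
    _ ≤ M ^ n * ‖F y‖ * ((5 : ℝ) ^ (6 * n) * t ^ (6 * n)) * ((4 * a) ^ (4 * n) * t ^ (4 * n)) :=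
        le_mul_of_one_le_right (by positivity) h2t
    _ = M ^ n * (5 : ℝ) ^ (6 * n) * (4 * a) ^ (4 * n) * (t ^ (10 * n) * ‖F y‖) := by ring
    _ ≤ M ^ n * (5 : ℝ) ^ (6 * n) * (4 * a) ^ (4 * n) * S := by gcongr
    _ = M ^ n * 4 ^ (4 * n) * 5 ^ (6 * n) * a ^ (4 * n) * S := by rw [mul_pow 4 a]; ring

/-- **Near-diagonal, shifted.** -/
theorem weight_bound_near' (F : 𝓢((Fin n → E4), ℂ)) (hF : IsOffDiagonal F) {a s : ℝ} (ha : 0 < a)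
    (x : Fin n → Site 4) {i j : Fin n} (hij : i ≠ j) (hclose : ‖x i - x j‖ ≤ 5)
    (y : Fin n → E4) (hyx : ∀ l, ‖y l - a • siteToE (x l)‖ ≤ s * a) {W M : ℝ} (hM : 0 ≤ M)
    (hW : |W| ≤ M ^ n) :
    |W| * ‖F y‖ * (1 + ‖y‖) ^ (6 * n) ≤
      M ^ n * 2 ^ (6 * n) * (10 + 2 * s) ^ (4 * n) * a ^ (4 * n) *
        (SchwartzMap.seminorm ℂ 0 (4 * n) F + SchwartzMap.seminorm ℂ (6 * n) (4 * n) F) := by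
  have hsep : ‖y i - y j‖ ≤ (10 + 2 * s) * a := by
    have := norm_sub_le_of_shift ha.le hyx i j
    nlinarith
  have hflat0 := offDiagonal_pow_mul_norm_le F hF 0 (4 * n) hij y
  have hflat6 := offDiagonal_pow_mul_norm_le F hF (6 * n) (4 * n) hij y
  rw [pow_zero, one_mul] at hflat0
  have hpw : ‖y i - y j‖ ^ (4 * n) ≤ ((10 + 2 * s) * a) ^ (4 * n) := pow_le_pow_left₀ (norm_nonneg _) hsep _
  have hA : ‖F y‖ ≤ SchwartzMap.seminorm ℂ 0 (4 * n) F * ((10 + 2 * s) * a) ^ (4 * n) :=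
    hflat0.trans (mul_le_mul_of_nonneg_left hpw (apply_nonneg _ _))
  have hB : ‖y‖ ^ (6 * n) * ‖F y‖ ≤ SchwartzMap.seminorm ℂ (6 * n) (4 * n) F * ((10 + 2 * s) * a) ^ (4 * n) :=
    hflat6.trans (mul_le_mul_of_nonneg_left hpw (apply_nonneg _ _))
  have hcomb := norm_mul_one_add_pow_le hA hB
  have hWn : 0 ≤ |W| := abs_nonneg _
  calc |W| * ‖F y‖ * (1 + ‖y‖) ^ (6 * n) = |W| * (‖F y‖ * (1 + ‖y‖) ^ (6 * n)) := by ring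
    _ ≤ M ^ n * (2 ^ (6 * n) * (SchwartzMap.seminorm ℂ 0 (4 * n) F * ((10 + 2 * s) * a) ^ (4 * n) +
          SchwartzMap.seminorm ℂ (6 * n) (4 * n) F * ((10 + 2 * s) * a) ^ (4 * n))) := by gcongr
    _ = M ^ n * 2 ^ (6 * n) * (10 + 2 * s) ^ (4 * n) * a ^ (4 * n) *
        (SchwartzMap.seminorm ℂ 0 (4 * n) F + SchwartzMap.seminorm ℂ (6 * n) (4 * n) F) := by
        rw [mul_pow (10 + 2 * s) a]; ring

/-- **Separated regime, shifted** (`s ≤ δ`). -/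
theorem weight_bound_far' (F : 𝓢((Fin n → E4), ℂ)) (hF : IsOffDiagonal F) {a s : ℝ} (ha : 0 < a)
    (x : Fin n → Site 4) {i j : Fin n} (hij : i ≠ j) {δ : ℝ} (hδ : 0 < δ) (hsδ : s ≤ δ)
    (hδx : ‖x i - x j‖ ≤ δ) (y : Fin n → E4) (hyx : ∀ l, ‖y l - a • siteToE (x l)‖ ≤ s * a)
    {W C R ℓ₄ : ℝ} (hC : 0 ≤ C) (hR : 0 < R) (hℓ : 0 < ℓ₄) (hW : |W| ≤ (C / R ^ 4) ^ n)
    (hRinv : R⁻¹ ≤ 12 / δ + a * (2 / ℓ₄ + 24)) :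
    |W| * ‖F y‖ * (1 + ‖y‖) ^ (6 * n) ≤
      (16 * C) ^ n * 2 ^ (6 * n) * (2 / ℓ₄ + 48) ^ (4 * n) * a ^ (4 * n) *
        (SchwartzMap.seminorm ℂ 0 (4 * n) F + SchwartzMap.seminorm ℂ (6 * n) (4 * n) F +
          SchwartzMap.seminorm ℂ 0 0 F + SchwartzMap.seminorm ℂ (6 * n) 0 F) := by
  set κ : ℝ := 2 / ℓ₄ + 48 with hκ
  have h2ℓ : 0 < 2 / ℓ₄ := div_pos two_pos hℓ
  have hκ48 : (48 : ℝ) ≤ κ := by rw [hκ]; linarith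
  have hκpos : 0 < κ := by linarith
  have hRinv' : R⁻¹ ≤ 12 / δ + a * κ := hRinv.trans (by rw [hκ]; nlinarith)
  -- Step 1: `C / R^4 ≤ 8 C ((12/δ)^4 + (a κ)^4)`
  have hR4 : (R ^ 4)⁻¹ ≤ 8 * ((12 / δ) ^ 4 + (a * κ) ^ 4) := by
    have h1 : (R ^ 4)⁻¹ = (R⁻¹) ^ 4 := by rw [inv_pow]
    rw [h1]
    have h2 : R⁻¹ ^ 4 ≤ (12 / δ + a * κ) ^ 4 := pow_le_pow_left₀ (by positivity) hRinv' 4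
    refine h2.trans ?_
    have hu : 0 ≤ 12 / δ := by positivity
    have hv : 0 ≤ a * κ := by positivity
    nlinarith [sq_nonneg (12 / δ - a * κ), sq_nonneg ((12 / δ) ^ 2 - (a * κ) ^ 2),
      mul_nonneg hu hv, sq_nonneg (12 / δ + a * κ), mul_nonneg (mul_nonneg hu hv) (sq_nonneg (12 / δ - a * κ))]
  have hCR : C / R ^ 4 ≤ 8 * C * ((12 / δ) ^ 4 + (a * κ) ^ 4) := by
    rw [div_eq_mul_inv]
    calc C * (R ^ 4)⁻¹ ≤ C * (8 * ((12 / δ) ^ 4 + (a * κ) ^ 4)) := mul_le_mul_of_nonneg_left hR4 hC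
      _ = 8 * C * ((12 / δ) ^ 4 + (a * κ) ^ 4) := by ring
  -- Step 2: `|W| ≤ (16 C)^n ((12/δ)^{4n} + (aκ)^{4n})`
  have hWle : |W| ≤ (16 * C) ^ n * ((12 / δ) ^ (4 * n) + (a * κ) ^ (4 * n)) := by
    have h1 : |W| ≤ (8 * C * ((12 / δ) ^ 4 + (a * κ) ^ 4)) ^ n :=
      hW.trans (pow_le_pow_left₀ (by positivity) hCR n)
    refine h1.trans ?_
    rw [mul_pow]
    have hpq : ((12 / δ) ^ 4 + (a * κ) ^ 4) ^ n ≤ 2 ^ n * (((12 / δ) ^ 4) ^ n + ((a * κ) ^ 4) ^ n) := by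
      have hp : 0 ≤ (12 / δ) ^ 4 := by positivity
      have hq : 0 ≤ (a * κ) ^ 4 := by positivity
      calc ((12 / δ) ^ 4 + (a * κ) ^ 4) ^ n ≤ (2 * max ((12 / δ) ^ 4) ((a * κ) ^ 4)) ^ n := by
            refine pow_le_pow_left₀ (by positivity) ?_ n
            rcases le_total ((12 / δ) ^ 4) ((a * κ) ^ 4) with h | h
            · rw [max_eq_right h]; linarith
            · rw [max_eq_left h]; linarith
        _ = 2 ^ n * (max ((12 / δ) ^ 4) ((a * κ) ^ 4)) ^ n := mul_pow _ _ _
        _ ≤ 2 ^ n * (((12 / δ) ^ 4) ^ n + ((a * κ) ^ 4) ^ n) := by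
            gcongr
            rcases le_total ((12 / δ) ^ 4) ((a * κ) ^ 4) with h | h
            · rw [max_eq_right h]; linarith [pow_nonneg hp n]
            · rw [max_eq_left h]; linarith [pow_nonneg hq n]
    calc (8 * C) ^ n * ((12 / δ) ^ 4 + (a * κ) ^ 4) ^ n
        ≤ (8 * C) ^ n * (2 ^ n * (((12 / δ) ^ 4) ^ n + ((a * κ) ^ 4) ^ n)) := by gcongr
      _ = (16 * C) ^ n * ((12 / δ) ^ (4 * n) + (a * κ) ^ (4 * n)) := by
          rw [← pow_mul, ← pow_mul, show (16 : ℝ) * C = 8 * C * 2 by ring, mul_pow (8 * C) 2 n]; ring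
  -- Step 3: flat decay for the `δ`-part: `‖yᵢ − yⱼ‖ ≤ 2aδ + 2sa ≤ 4aδ`
  have hsep : ‖y i - y j‖ ≤ 4 * a * δ := by
    have h1 := norm_sub_le_of_shift ha.le hyx i j
    have h2 : (2 * a) * ‖x i - x j‖ ≤ (2 * a) * δ := mul_le_mul_of_nonneg_left hδx (by positivity)
    nlinarith
  have hflat0 := offDiagonal_pow_mul_norm_le F hF 0 (4 * n) hij y
  have hflat6 := offDiagonal_pow_mul_norm_le F hF (6 * n) (4 * n) hij y
  rw [pow_zero, one_mul] at hflat0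
  have hpw : ‖y i - y j‖ ^ (4 * n) ≤ (4 * a * δ) ^ (4 * n) := pow_le_pow_left₀ (norm_nonneg _) hsep _
  have hδpow : (12 / δ) ^ (4 * n) * (4 * a * δ) ^ (4 * n) = (48 * a) ^ (4 * n) := by
    rw [← mul_pow]; congr 1; field_simp; ring
  have hA : ‖(((12 / δ) ^ (4 * n) : ℝ) : ℂ) • F y‖ ≤ SchwartzMap.seminorm ℂ 0 (4 * n) F * (48 * a) ^ (4 * n) := by
    rw [norm_smul, Complex.norm_real, Real.norm_of_nonneg (by positivity)]
    calc (12 / δ) ^ (4 * n) * ‖F y‖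
        ≤ (12 / δ) ^ (4 * n) * (SchwartzMap.seminorm ℂ 0 (4 * n) F * (4 * a * δ) ^ (4 * n)) := by
          gcongr; exact hflat0.trans (mul_le_mul_of_nonneg_left hpw (apply_nonneg _ _))
      _ = SchwartzMap.seminorm ℂ 0 (4 * n) F * ((12 / δ) ^ (4 * n) * (4 * a * δ) ^ (4 * n)) := by ring
      _ = _ := by rw [hδpow]
  have hB : ‖y‖ ^ (6 * n) * ‖(((12 / δ) ^ (4 * n) : ℝ) : ℂ) • F y‖ ≤
      SchwartzMap.seminorm ℂ (6 * n) (4 * n) F * (48 * a) ^ (4 * n) := by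
    rw [norm_smul, Complex.norm_real, Real.norm_of_nonneg (by positivity)]
    calc ‖y‖ ^ (6 * n) * ((12 / δ) ^ (4 * n) * ‖F y‖) = (12 / δ) ^ (4 * n) * (‖y‖ ^ (6 * n) * ‖F y‖) := by ring
      _ ≤ (12 / δ) ^ (4 * n) * (SchwartzMap.seminorm ℂ (6 * n) (4 * n) F * (4 * a * δ) ^ (4 * n)) :=
          mul_le_mul_of_nonneg_left (hflat6.trans (mul_le_mul_of_nonneg_left hpw (apply_nonneg _ _)))
            (by positivity)
      _ = SchwartzMap.seminorm ℂ (6 * n) (4 * n) F * ((12 / δ) ^ (4 * n) * (4 * a * δ) ^ (4 * n)) := by ring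
      _ = _ := by rw [hδpow]
  have hcomb1 := norm_mul_one_add_pow_le hA hB
  rw [norm_smul, Complex.norm_real, Real.norm_of_nonneg (by positivity : (0:ℝ) ≤ (12 / δ) ^ (4 * n))] at hcomb1
  -- Step 4: plain decay for the constant part
  have hA0 : ‖F y‖ ≤ SchwartzMap.seminorm ℂ 0 0 F := by
    have := pow_mul_norm_le_seminorm F 0 y; rwa [pow_zero, one_mul] at this
  have hB0 : ‖y‖ ^ (6 * n) * ‖F y‖ ≤ SchwartzMap.seminorm ℂ (6 * n) 0 F := pow_mul_norm_le_seminorm F (6 * n) y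
  have hcomb2 := norm_mul_one_add_pow_le hA0 hB0
  -- Step 5: assemble
  set S04 := SchwartzMap.seminorm ℂ 0 (4 * n) F
  set S64 := SchwartzMap.seminorm ℂ (6 * n) (4 * n) F
  set S00 := SchwartzMap.seminorm ℂ 0 0 F
  set S60 := SchwartzMap.seminorm ℂ (6 * n) 0 F
  have hpos1 : 0 ≤ ‖F y‖ * (1 + ‖y‖) ^ (6 * n) := by positivity
  calc |W| * ‖F y‖ * (1 + ‖y‖) ^ (6 * n) = |W| * (‖F y‖ * (1 + ‖y‖) ^ (6 * n)) := by ring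
    _ ≤ (16 * C) ^ n * ((12 / δ) ^ (4 * n) + (a * κ) ^ (4 * n)) * (‖F y‖ * (1 + ‖y‖) ^ (6 * n)) :=
        mul_le_mul_of_nonneg_right hWle hpos1
    _ = (16 * C) ^ n * ((12 / δ) ^ (4 * n) * ‖F y‖ * (1 + ‖y‖) ^ (6 * n)) +
        (16 * C) ^ n * (a * κ) ^ (4 * n) * (‖F y‖ * (1 + ‖y‖) ^ (6 * n)) := by ring
    _ ≤ (16 * C) ^ n * (2 ^ (6 * n) * (S04 * (48 * a) ^ (4 * n) + S64 * (48 * a) ^ (4 * n))) +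
        (16 * C) ^ n * (a * κ) ^ (4 * n) * (2 ^ (6 * n) * (S00 + S60)) := by gcongr
    _ = (16 * C) ^ n * 2 ^ (6 * n) * a ^ (4 * n) * ((48 : ℝ) ^ (4 * n) * (S04 + S64) + κ ^ (4 * n) * (S00 + S60)) := by
        rw [mul_pow 48 a, mul_pow a κ]; ring
    _ ≤ (16 * C) ^ n * 2 ^ (6 * n) * a ^ (4 * n) * (κ ^ (4 * n) * (S04 + S64) + κ ^ (4 * n) * (S00 + S60)) := by
        gcongr
    _ = (16 * C) ^ n * 2 ^ (6 * n) * κ ^ (4 * n) * a ^ (4 * n) * (S04 + S64 + S00 + S60) := by ring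

/-! ### All regimes, abstract weights -/

/-- **Separated regime of the per-point bound, abstract weights, shifted points.** -/
theorem pointwise_bound_far' {C ℓ₄ a s : ℝ} {L n : ℕ} (hℓ : 0 < ℓ₄) (hC : 0 ≤ C)
    (W : (Fin n → Site 4) → ℝ)
    (H : ∀ (x : Fin n → Site 4) (R : ℕ), 1 ≤ R → (R : ℝ) * a ≤ ℓ₄ → 4 * R + 8 ≤ L →
      (∀ i j : Fin n, i ≠ j → ∃ k : Fin 4,
        (2 * (R : ℤ) + 4) ≤ |((((x i k - x j k : ℤ) : ZMod (2 * L + 1))).valMinAbs : ℤ)|) →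
      |W x| ≤ (C / (R : ℝ) ^ 4) ^ n)
    (ha : 0 < a) (ha1 : a ≤ 1) (haℓ : a ≤ ℓ₄) (hL14 : 14 ≤ L) (hLa : a⁻¹ * a⁻¹ ≤ L) (hn : 2 ≤ n)
    (hs6 : s ≤ 6) (F : 𝓢((Fin n → E4), ℂ)) (hF : IsOffDiagonal F) (x : Fin n → Site 4)
    (y : Fin n → E4) (hyx : ∀ l, ‖y l - a • siteToE (x l)‖ ≤ s * a)
    (hwrap : ∀ i, 2 * ‖x i‖ ≤ (L : ℝ)) (hnear : ∀ i j : Fin n, i ≠ j → 5 < ‖x i - x j‖) :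
    |W x| * ‖F y‖ * (1 + ‖y‖) ^ (6 * n) ≤
      (16 * C) ^ n * 2 ^ (6 * n) * (2 / ℓ₄ + 48) ^ (4 * n) * a ^ (4 * n) *
        (SchwartzMap.seminorm ℂ 0 (4 * n) F + SchwartzMap.seminorm ℂ (6 * n) (4 * n) F +
          SchwartzMap.seminorm ℂ 0 0 F + SchwartzMap.seminorm ℂ (6 * n) 0 F) := by
  classical
  have hpairs : (Finset.univ.filter fun p : Fin n × Fin n => p.1 ≠ p.2).Nonempty := by
    refine ⟨(⟨0, by omega⟩, ⟨1, by omega⟩), ?_⟩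
    simp [Fin.ext_iff]
  obtain ⟨⟨i₀, j₀⟩, hmem, hmin⟩ :=
    Finset.exists_min_image _ (fun p : Fin n × Fin n => ‖x p.1 - x p.2‖) hpairs
  simp only [Finset.mem_filter, Finset.mem_univ, true_and] at hmem
  set δ : ℝ := ‖x i₀ - x j₀‖ with hδ
  have hδ5 : 5 < δ := hnear i₀ j₀ hmem
  have hδmin : ∀ i j : Fin n, i ≠ j → δ ≤ ‖x i - x j‖ := fun i j hij =>
    hmin (i, j) (by simp [hij])
  have hδ6 : 6 ≤ δ := by
    obtain ⟨k₀, hk₀⟩ := exists_norm_eq_abs_coord (x i₀ - x j₀)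
    have h1 : δ = ((|(x i₀ - x j₀) k₀| : ℤ) : ℝ) := by rw [hδ, hk₀, Int.cast_abs]
    have h2 : (5 : ℝ) < ((|(x i₀ - x j₀) k₀| : ℤ) : ℝ) := h1 ▸ hδ5
    have h3 : (5 : ℤ) < |(x i₀ - x j₀) k₀| := by exact_mod_cast h2
    have h4 : (6 : ℤ) ≤ |(x i₀ - x j₀) k₀| := h3
    rw [h1]; exact_mod_cast h4
  have hδpos : 0 < δ := by linarith
  obtain ⟨R, hR1, hRa, hRL, hRδ, hRinv⟩ := exists_collar_radius hδ6 hℓ ha ha1 haℓ hL14 hLa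
  have hRpos : (0 : ℝ) < R := by exact_mod_cast hR1
  have hsepR : ∀ i j : Fin n, i ≠ j → ∃ k : Fin 4,
      (2 * (R : ℤ) + 4) ≤ |((((x i k - x j k : ℤ) : ZMod (2 * L + 1))).valMinAbs : ℤ)| := by
    intro i j hij
    obtain ⟨k, hk⟩ := exists_valMinAbs_ge_of_norm_le x hwrap i j (hRδ.trans (hδmin i j hij))
    exact ⟨k, by exact_mod_cast hk⟩
  exact weight_bound_far' F hF ha x hmem hδpos (hs6.trans hδ6) (le_of_eq hδ.symm) y hyx hC hRpos hℓ
    (H x R hR1 hRa hRL hsepR) hRinv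

/-- **Per-point bound, all regimes, abstract weights, shifted points.**  With sup bound `Mⁿ` and collar bound
`(C/R⁴)ⁿ` on `W`, and `K₀ = M·4⁴·5⁶ + M·2⁶·(10+2s)⁴ + 16C·2⁶·(2/ℓ₄+48)⁴`. -/
theorem pointwise_bound' {C ℓ₄ M a s : ℝ} {L n : ℕ} (hℓ : 0 < ℓ₄) (hC : 0 ≤ C) (hM : 0 ≤ M)
    (W : (Fin n → Site 4) → ℝ) (hWsup : ∀ x, |W x| ≤ M ^ n)
    (H : ∀ (x : Fin n → Site 4) (R : ℕ), 1 ≤ R → (R : ℝ) * a ≤ ℓ₄ → 4 * R + 8 ≤ L →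
      (∀ i j : Fin n, i ≠ j → ∃ k : Fin 4,
        (2 * (R : ℤ) + 4) ≤ |((((x i k - x j k : ℤ) : ZMod (2 * L + 1))).valMinAbs : ℤ)|) →
      |W x| ≤ (C / (R : ℝ) ^ 4) ^ n)
    (ha : 0 < a) (ha1 : a ≤ 1) (haℓ : a ≤ ℓ₄) (hL14 : 14 ≤ L) (hLa : a⁻¹ * a⁻¹ ≤ L) (hn : 2 ≤ n)
    (hs : 0 ≤ s) (hs6 : s ≤ 6) (hsa : s * a ≤ 1 / 4)
    (F : 𝓢((Fin n → E4), ℂ)) (hF : IsOffDiagonal F) (x : Fin n → Site 4)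
    (y : Fin n → E4) (hyx : ∀ l, ‖y l - a • siteToE (x l)‖ ≤ s * a) :
    |W x| * ‖F y‖ * (1 + ‖y‖) ^ (6 * n) ≤
      (M * 4 ^ 4 * 5 ^ 6 + M * 2 ^ 6 * (10 + 2 * s) ^ 4 + 16 * C * 2 ^ 6 * (2 / ℓ₄ + 48) ^ 4) ^ n *
        a ^ (4 * n) *
        (SchwartzMap.seminorm ℂ 0 (4 * n) F + SchwartzMap.seminorm ℂ (6 * n) (4 * n) F +
          SchwartzMap.seminorm ℂ 0 0 F + SchwartzMap.seminorm ℂ (6 * n) 0 F +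
          SchwartzMap.seminorm ℂ (10 * n) 0 F) := by
  classical
  set κ : ℝ := 2 / ℓ₄ + 48 with hκ
  have hκ0 : 0 < κ := by rw [hκ]; positivity
  set σ : ℝ := 10 + 2 * s with hσ
  have hσ0 : 0 < σ := by rw [hσ]; linarith
  set K₀ : ℝ := M * 4 ^ 4 * 5 ^ 6 + M * 2 ^ 6 * σ ^ 4 + 16 * C * 2 ^ 6 * κ ^ 4 with hK₀
  set S04 := SchwartzMap.seminorm ℂ 0 (4 * n) F
  set S64 := SchwartzMap.seminorm ℂ (6 * n) (4 * n) F
  set S00 := SchwartzMap.seminorm ℂ 0 0 F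
  set S60 := SchwartzMap.seminorm ℂ (6 * n) 0 F
  set S10 := SchwartzMap.seminorm ℂ (10 * n) 0 F
  have hS04 : 0 ≤ S04 := apply_nonneg _ _
  have hS64 : 0 ≤ S64 := apply_nonneg _ _
  have hS00 : 0 ≤ S00 := apply_nonneg _ _
  have hS60 : 0 ≤ S60 := apply_nonneg _ _
  have hS10 : 0 ≤ S10 := apply_nonneg _ _
  have ha4 : 0 ≤ a ^ (4 * n) := by positivity
  have hKwrap : M * 4 ^ 4 * 5 ^ 6 ≤ K₀ := by rw [hK₀]; nlinarith [pow_pos hκ0 4, pow_pos hσ0 4]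
  have hKnear : M * 2 ^ 6 * σ ^ 4 ≤ K₀ := by rw [hK₀]; nlinarith [pow_pos hκ0 4, pow_pos hσ0 4]
  have hKfar : 16 * C * 2 ^ 6 * κ ^ 4 ≤ K₀ := by rw [hK₀]; nlinarith [pow_pos hκ0 4, pow_pos hσ0 4]
  have hK₀0 : 0 ≤ K₀ := le_trans (by positivity) hKwrap
  have hpow : ∀ u v w : ℝ, ∀ p q : ℕ, u ^ n * v ^ (p * n) * w ^ (q * n) = (u * v ^ p * w ^ q) ^ n := by
    intro u v w p q; rw [mul_pow, mul_pow, ← pow_mul, ← pow_mul]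
  by_cases hwrap : ∃ i, (L : ℝ) < 2 * ‖x i‖
  · obtain ⟨i, hi⟩ := hwrap
    calc _ ≤ M ^ n * 4 ^ (4 * n) * 5 ^ (6 * n) * a ^ (4 * n) * S10 :=
          weight_bound_wrap' F ha ha1 hsa hLa x hi y hyx hM (hWsup x)
      _ = (M * 4 ^ 4 * 5 ^ 6) ^ n * a ^ (4 * n) * S10 := by rw [← hpow]
      _ ≤ K₀ ^ n * a ^ (4 * n) * (S04 + S64 + S00 + S60 + S10) := by
          have : S10 ≤ S04 + S64 + S00 + S60 + S10 := by linarith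
          gcongr
  · push Not at hwrap
    by_cases hnear : ∃ i j : Fin n, i ≠ j ∧ ‖x i - x j‖ ≤ 5
    · obtain ⟨i, j, hij, hclose⟩ := hnear
      calc _ ≤ M ^ n * 2 ^ (6 * n) * σ ^ (4 * n) * a ^ (4 * n) * (S04 + S64) :=
            weight_bound_near' F hF ha x hij hclose y hyx hM (hWsup x)
        _ = (M * 2 ^ 6 * σ ^ 4) ^ n * a ^ (4 * n) * (S04 + S64) := by rw [← hpow]
        _ ≤ K₀ ^ n * a ^ (4 * n) * (S04 + S64 + S00 + S60 + S10) := by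
            have : S04 + S64 ≤ S04 + S64 + S00 + S60 + S10 := by linarith
            gcongr
    · push Not at hnear
      calc _ ≤ (16 * C) ^ n * 2 ^ (6 * n) * κ ^ (4 * n) * a ^ (4 * n) * (S04 + S64 + S00 + S60) :=
            pointwise_bound_far' hℓ hC W H ha ha1 haℓ hL14 hLa hn hs6 F hF x y hyx hwrap hnear
        _ = (16 * C * 2 ^ 6 * κ ^ 4) ^ n * a ^ (4 * n) * (S04 + S64 + S00 + S60) := by rw [← hpow]
        _ ≤ K₀ ^ n * a ^ (4 * n) * (S04 + S64 + S00 + S60 + S10) := by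
            have : S04 + S64 + S00 + S60 ≤ S04 + S64 + S00 + S60 + S10 := by linarith
            gcongr

end Summit.QuantumFields.YangMills.Theorems.OSLegsFromFemtoAndGap

end
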